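import Literature.AlgebraicGeometry.Resolution.RegularQuotientIdeal
import Literature.AlgebraicGeometry.Resolution.ResiduallyIndependentSplitting
import Literature.RingTheory.Smooth.FieldCharP
import Mathlib.RingTheory.Smooth.Local
import Mathlib.RingTheory.Smooth.Locus
import Mathlib.RingTheory.Etale.Kaehler
import Mathlib.RingTheory.RegularLocalRing.Polynomial
import Mathlib.Algebra.Algebra.ZMod
import HarnessLib

/-!
# Regular local rings essentially of finite type over a field of characteristic `p` are
# formally smooth over the prime field `𝔽_p`

Topic: `Literature/AlgebraicGeometry/Resolution`. Companion of `RegularImpliesSmooth.lean`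
(Stacks 00TV: `B_𝔮` regular with `κ(𝔮)/k` separable ⇒ `B` smooth over `k` at `𝔮`) with the
ground field `k` replaced by the PRIME FIELD `𝔽_p`: over `𝔽_p` every residue field is separable
(Matsumura, *Commutative Ring Theory*, Thm. 26.9 with Thm. 26.3; tree:
`Literature.RingTheory.Smooth.formallySmooth_of_charP`), so NO separability hypothesis is needed,
at the price that `B` is no longer of finite type over the base and the module of differentials
`Ω_{P/𝔽_p}` of the presentation `P = k[X]_𝔓 ↠ B_𝔮` is projective of possibly infinite rank
instead of finite free. Everything is PROVED:

* (`ResiduallyIndependentSplitting.lean`, `exists_linearMap_apply_eq_single`) — residually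
  independent elements `m_1, …, m_c` of a PROJECTIVE module `F` over a local ring split off:
  `φ : F → A^c`, `φ(mᵢ) = eᵢ`;
* `formallySmooth_zmod_localization_of_isRegularLocalRing` — **for `B` of finite type over a
  field `k` of characteristic `p` and a prime `𝔮` with `B_𝔮` regular, `B_𝔮` is formally smooth
  over `𝔽_p`** (Stacks 031I, `Algebra.FormallySmooth.iff_split_injection`, for the presentation
  `P = k[X]_𝔓 ↠ B_𝔮`: `P` is formally smooth over `𝔽_p` as `k/𝔽_p` is; the kernel is generated by
  `f_1, …, f_c` with independent differentials in `𝔪_P/𝔪_P²` (Matsumura 14.2,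
  `exists_span_eq_of_isRegularLocalRing_quotient`), which stay independent in
  `κ ⊗ Ω_{P/𝔽_p}` because `𝔪_P/𝔪_P² → κ ⊗ Ω_{P/𝔽_p}` is split injective (`κ` formally smooth over
  `𝔽_p`), so `I/I² → B_𝔮 ⊗ Ω_{P/𝔽_p}` splits by the previous item);
* `formallySmooth_zmod_of_isRegularLocalRing_of_essFiniteType` — the same for a regular local
  ring essentially of finite type over `k`.

Consequence (`DualDerivationsPrimeField.lean`): such rings carry derivations `∂ᵢ` dual to any
regular system of parameters, over an ARBITRARY ground field of characteristic `p`.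

## Sources

* The Stacks Project, Tag 031I (formal smoothness and splitting of `I/I² → Ω ⊗ S`), Tag 00TV.
  [StacksProject]
* H. Matsumura, *Commutative Ring Theory*, CUP 1986, Thm. 26.9 with Thm. 26.3 (fields are
  `0`-smooth over perfect subfields), Thm. 14.2, Thm. 28.7 (regular ⟺ `𝔪`-smooth over a
  subfield with separable residue field extension; the discrete statement proved here is its
  essentially-of-finite-type strengthening). [Matsumura1987]
-/

noncomputable section

namespace Literature.AlgebraicGeometry.Resolution

universe u v

open IsLocalRing Module TensorProduct KaehlerDifferential

/-! ## Formal smoothness over the prime field -/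

section PrimeField

/-- **A regular local ring `B_𝔮` of a finite type algebra `B` over a field of characteristic
`p` is formally smooth over the prime field `𝔽_p`** (no hypothesis on the residue field).
Presentation `P = k[X]_𝔓 ↠ B_𝔮`, `P` formally smooth over `𝔽_p` (`k/𝔽_p` is: Matsumura 26.9);
the kernel is generated by `f_1, …, f_c` with linearly independent differentials in `𝔪_P/𝔪_P²`
(Matsumura 14.2); as the residue field `κ` is formally smooth over `𝔽_p`,
`𝔪_P/𝔪_P² → κ ⊗ Ω_{P/𝔽_p}` is split injective, so the `dfᵢ` are residually independent in the
projective `B_𝔮`-module `B_𝔮 ⊗ Ω_{P/𝔽_p}` and `I/I² → B_𝔮 ⊗ Ω_{P/𝔽_p}` splits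
(`exists_linearMap_apply_eq_single`); conclude by Stacks 031I
(`Algebra.Extension.formallySmooth_iff_split_injection`). [cite: StacksProject, Tag 031I] -/
theorem formallySmooth_zmod_localization_of_isRegularLocalRing (p : ℕ) [Fact p.Prime]
    (k B : Type u) [Field k] [CharP k p] [CommRing B] [Algebra k B] [Algebra.FiniteType k B]
    (q : Ideal B) [q.IsPrime] [hreg : IsRegularLocalRing (Localization.AtPrime q)]
    [Algebra (ZMod p) (Localization.AtPrime q)] :
    Algebra.FormallySmooth (ZMod p) (Localization.AtPrime q) := by
  classical
  -- adapted from `isSmoothAt_of_isRegularLocalRing_of_formallySmooth_residueField`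
  -- (`RegularImpliesSmooth.lean`): the same presentation, over the prime field
  let S := Localization.AtPrime q
  letI : Algebra (ZMod p) k := ZMod.algebra k p
  -- a presentation `P = k[X]_𝔓 ↠ S = B_q`
  obtain ⟨n, f₀, hf₀⟩ := Algebra.FiniteType.iff_quotient_mvPolynomial''.mp
    (inferInstance : Algebra.FiniteType k B)
  let 𝔓 : Ideal (MvPolynomial (Fin n) k) := q.comap f₀
  haveI : 𝔓.IsPrime := Ideal.comap_isPrime f₀ q
  let P := Localization.AtPrime 𝔓
  haveI : IsRegularLocalRing P := IsRegularRing.isRegularLocalRing_localization 𝔓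
  let fP : P →ₐ[k] S := IsLocalization.liftAlgHom (M := 𝔓.primeCompl)
      (f := (IsScalarTower.toAlgHom k B S).comp f₀) fun x => by
    have hx : f₀ x.1 ∈ q.primeCompl := x.2
    simpa using IsLocalization.map_units (M := q.primeCompl) S ⟨f₀ x.1, hx⟩
  have hf₁ : Function.Surjective fP := by
    intro x
    obtain ⟨x, ⟨s, hs⟩, rfl⟩ := IsLocalization.exists_mk'_eq q.primeCompl x
    obtain ⟨x, rfl⟩ := hf₀ x
    obtain ⟨s, rfl⟩ := hf₀ s
    refine ⟨IsLocalization.mk' (M := 𝔓.primeCompl) P x ⟨s, hs⟩, ?_⟩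
    simp [fP, IsLocalization.lift_mk', Units.mul_inv_eq_iff_eq_mul, IsUnit.liftRight]
  algebraize [fP.toRingHom]
  haveI : IsScalarTower k P S := IsScalarTower.of_algebraMap_eq fun c => (fP.commutes c).symm
  -- `P` is formally smooth over `𝔽_p`
  haveI : Algebra.FormallySmooth (ZMod p) k :=
    Literature.RingTheory.Smooth.formallySmooth_of_charP p k
  haveI : Algebra.FormallySmooth (ZMod p) (MvPolynomial (Fin n) k) :=
    .comp (ZMod p) k (MvPolynomial (Fin n) k)
  haveI : Algebra.FormallyEtale (MvPolynomial (Fin n) k) P := .of_isLocalization 𝔓.primeCompl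
  haveI : Algebra.FormallySmooth (ZMod p) P := .comp (ZMod p) (MvPolynomial (Fin n) k) P
  -- the ideal `I` of the presentation lies in the maximal ideal; `P → S` is local
  set I : Ideal P := RingHom.ker (algebraMap P S) with hI
  have hf₁' : Function.Surjective (algebraMap P S) := hf₁
  have hmemP : ∀ x : P, algebraMap P S x ∈ maximalIdeal S → x ∈ maximalIdeal P := by
    intro x hx
    by_contra hxm
    have hxu : IsUnit x := not_not.mp fun h => hxm ((IsLocalRing.mem_maximalIdeal x).mpr h)
    exact (IsLocalRing.mem_maximalIdeal _).mp hx (hxu.map _)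
  have hIm : I ≤ maximalIdeal P := fun x hx =>
    hmemP x (by rw [RingHom.mem_ker.mp hx]; exact zero_mem _)
  have hmapm : ∀ x : P, x ∈ maximalIdeal P → algebraMap P S x ∈ maximalIdeal S := by
    intro x hx
    by_contra hxS
    have hu : IsUnit (algebraMap P S x) :=
      not_not.mp fun h => hxS ((IsLocalRing.mem_maximalIdeal _).mpr h)
    obtain ⟨y, hy⟩ := hf₁' (↑(hu.unit⁻¹) : S)
    have h1 : x * y - 1 ∈ I := by
      rw [hI, RingHom.mem_ker, map_sub, map_mul, hy, map_one, IsUnit.mul_val_inv, sub_self]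
    have h2 : x * y ∈ maximalIdeal P := Ideal.mul_mem_right _ _ hx
    have h3 : (1 : P) ∈ maximalIdeal P := by
      have := Ideal.sub_mem _ h2 (hIm h1)
      rwa [sub_sub_cancel] at this
    exact (IsLocalRing.maximalIdeal.isMaximal P).ne_top
      (Ideal.eq_top_of_isUnit_mem _ h3 isUnit_one)
  -- the residue field `𝕜` of `S` as a `P`-algebra; its kernel is `𝔪_P`
  let 𝕜 := ResidueField S
  have hPk : ∀ x : P, algebraMap P 𝕜 x = algebraMap S 𝕜 (algebraMap P S x) := fun x =>
    IsScalarTower.algebraMap_apply P S 𝕜 x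
  have hsurj𝕜 : Function.Surjective (algebraMap P 𝕜) := by
    rw [IsScalarTower.algebraMap_eq P S 𝕜]
    exact (residue_surjective (R := S)).comp hf₁'
  have hJ : RingHom.ker (algebraMap P 𝕜) = maximalIdeal P := by
    ext x
    rw [RingHom.mem_ker, hPk]
    change residue S (algebraMap P S x) = 0 ↔ _
    rw [residue_eq_zero_iff]
    exact ⟨hmemP x, hmapm x⟩
  -- `𝕜` is formally smooth over `𝔽_p`: `𝔪_P/𝔪_P² → 𝕜 ⊗ Ω_{P/𝔽_p}` is injective
  haveI : CharP 𝕜 p := charP_of_injective_algebraMap (algebraMap k 𝕜).injective p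
  have h𝕜 : Algebra.FormallySmooth (ZMod p) 𝕜 :=
    Literature.RingTheory.Smooth.formallySmooth_of_charP p 𝕜
  have hinjJ : Function.Injective (kerCotangentToTensor (ZMod p) P 𝕜) := by
    obtain ⟨l, hl⟩ := (Algebra.FormallySmooth.iff_split_injection hsurj𝕜).mp h𝕜
    refine Function.LeftInverse.injective (g := l) fun x => ?_
    exact LinearMap.congr_fun hl x
  -- `S ≅ P/I` regular ⇒ `I = (f₁, …, f_c)` with linearly independent differentials
  haveI : IsRegularLocalRing (P ⧸ I) :=
    IsRegularLocalRing.of_ringEquiv (RingHom.quotientKerEquivOfSurjective hf₁').symm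
  obtain ⟨c, f, hfI, hspan, hli⟩ :=
    exists_span_eq_of_isRegularLocalRing_quotient (R := P) (J := I) hIm (I : Set P)
      (Ideal.span_eq I)
  have hf' : ∀ i, f i ∈ maximalIdeal P := fun i => hIm (hfI i)
  -- KEY: `∑ bᵢ fᵢ ∈ 𝔪_P²` forces `bᵢ ∈ 𝔪_P`
  have hkey : ∀ b : Fin c → P, (∑ i, b i * f i) ∈ maximalIdeal P ^ 2 →
      ∀ i, b i ∈ maximalIdeal P := by
    intro b hb i
    have hsum : (maximalIdeal P).toCotangent
        (∑ j, b j • (⟨f j, hf' j⟩ : maximalIdeal P)) = 0 := by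
      rw [Ideal.toCotangent_eq_zero]
      have hcoe : (((∑ j, b j • (⟨f j, hf' j⟩ : maximalIdeal P)) : maximalIdeal P) : P) =
          ∑ j, b j * f j := by
        rw [AddSubmonoidClass.coe_finsetSum]
        exact Finset.sum_congr rfl fun j _ => rfl
      rw [hcoe]
      exact hb
    rw [map_sum] at hsum
    have hsum' : (∑ j, residue P (b j) • (maximalIdeal P).toCotangent ⟨f j, hf' j⟩) = 0 := by
      rw [← hsum]
      refine Finset.sum_congr rfl fun j _ => ?_
      rw [LinearMap.map_smul_of_tower]
      rfl
    have := Fintype.linearIndependent_iff.mp hli (fun j => residue P (b j)) hsum' i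
    exact (residue_eq_zero_iff _).mp this
  -- in `𝕜 ⊗ Ω_{P/𝔽_p}`: `∑ bᵢ • (1 ⊗ dfᵢ) = 0` forces `bᵢ ∈ 𝔪_P`
  have hkey𝕜 : ∀ b : Fin c → P,
      (∑ i, b i • ((1 : 𝕜) ⊗ₜ[P] D (ZMod p) P (f i))) = 0 → ∀ i, b i ∈ maximalIdeal P := by
    intro b hb
    apply hkey b
    have hgJ : (∑ i, b i * f i) ∈ RingHom.ker (algebraMap P 𝕜) := by
      rw [hJ]
      exact Ideal.sum_mem _ fun i _ => Ideal.mul_mem_left _ _ (hf' i)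
    have himg : kerCotangentToTensor (ZMod p) P 𝕜
        ((RingHom.ker (algebraMap P 𝕜)).toCotangent ⟨_, hgJ⟩) =
        ∑ i, b i • ((1 : 𝕜) ⊗ₜ[P] D (ZMod p) P (f i)) := by
      rw [kerCotangentToTensor_toCotangent]
      change (1 : 𝕜) ⊗ₜ[P] D (ZMod p) P (∑ i, b i * f i) = _
      rw [map_sum, tmul_sum]
      refine Finset.sum_congr rfl fun i _ => ?_
      rw [Derivation.leibniz, tmul_add]
      have h0 : (1 : 𝕜) ⊗ₜ[P] (f i • D (ZMod p) P (b i)) = 0 := by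
        rw [tmul_smul, smul_tmul', Algebra.smul_def, mul_one]
        have : algebraMap P 𝕜 (f i) = 0 := by
          rw [← RingHom.mem_ker, hJ]
          exact hf' i
        rw [this, zero_tmul]
      rw [h0, add_zero, tmul_smul]
    have h1 : (RingHom.ker (algebraMap P 𝕜)).toCotangent ⟨_, hgJ⟩ = 0 :=
      hinjJ (himg.trans (hb.trans (map_zero _).symm))
    have h2 : (∑ i, b i * f i) ∈ RingHom.ker (algebraMap P 𝕜) ^ 2 :=
      (Ideal.toCotangent_eq_zero _ _).mp h1
    rwa [hJ] at h2
  -- the extension `P ↠ S` of `𝔽_p`-algebras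
  let P' : Algebra.Extension (ZMod p) S := ⟨P, _, Function.surjInv_eq hf₁'⟩
  haveI : Algebra.FormallySmooth (ZMod p) P'.Ring := ‹Algebra.FormallySmooth (ZMod p) P›
  rw [Algebra.Extension.formallySmooth_iff_split_injection P']
  have hfker : ∀ i, f i ∈ P'.ker := fun i => hfI i
  have hspan' : Ideal.span (Set.range f) = P'.ker := hspan
  let x : Fin c → P'.ker := fun i => ⟨f i, hfker i⟩
  let m : Fin c → P'.CotangentSpace := fun i =>
    P'.cotangentComplex (Algebra.Extension.Cotangent.mk (x i))
  have hmi : ∀ i, m i = (1 : S) ⊗ₜ[P] D (ZMod p) P (f i) := fun i =>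
    P'.cotangentComplex_mk (x i)
  haveI : Module.Projective S P'.CotangentSpace := inferInstance
  -- residual independence of the `1 ⊗ dfᵢ` in `S ⊗ Ω_{P/𝔽_p}`
  have hm' : ∀ a : Fin c → S,
      (∑ i, a i • m i) ∈ (maximalIdeal S) • (⊤ : Submodule S P'.CotangentSpace) →
      ∀ i, a i ∈ maximalIdeal S := by
    intro a ha i
    choose b hb using fun i => hf₁' (a i)
    -- the `P`-linear map `S ⊗ Ω → 𝕜 ⊗ Ω` kills `𝔪_S • (S ⊗ Ω)`
    let g : P'.CotangentSpace →ₗ[P] (𝕜 ⊗[P] Ω[P⁄ZMod p]) :=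
      LinearMap.rTensor (Ω[P⁄ZMod p]) ((Algebra.linearMap S 𝕜).restrictScalars P)
    have hg : ∀ (t : S) (ω : Ω[P⁄ZMod p]), g (t ⊗ₜ[P] ω) = (algebraMap S 𝕜 t) ⊗ₜ[P] ω :=
      fun t ω => by rw [LinearMap.rTensor_tmul]; rfl
    have hg0 : ∀ z ∈ (maximalIdeal S) • (⊤ : Submodule S P'.CotangentSpace), g z = 0 := by
      intro z₀ hz₀
      refine Submodule.smul_induction_on hz₀ (fun s hs z hz => ?_)
        (fun z₁ z₂ h₁ h₂ => by rw [map_add, h₁, h₂, add_zero])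
      clear hz
      induction z using TensorProduct.induction_on with
      | zero => rw [smul_zero, map_zero]
      | tmul t ω =>
        rw [smul_tmul', hg, smul_eq_mul, map_mul]
        have hs0 : algebraMap S 𝕜 s = 0 := by
          rw [ResidueField.algebraMap_eq, residue_eq_zero_iff]
          exact hs
        rw [hs0, zero_mul, zero_tmul]
      | add z₁ z₂ h₁ h₂ => rw [smul_add, map_add, h₁, h₂, add_zero]
    have h1 : g (∑ i, a i • m i) = ∑ i, b i • ((1 : 𝕜) ⊗ₜ[P] D (ZMod p) P (f i)) := by
      rw [map_sum]
      refine Finset.sum_congr rfl fun i _ => ?_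
      rw [← hb i, algebraMap_smul, map_smul, hmi, hg, map_one]
    have h2 : ∀ i, b i ∈ maximalIdeal P := hkey𝕜 b (h1 ▸ hg0 _ ha)
    rw [← hb i]
    exact hmapm _ (h2 i)
  obtain ⟨φ, hφ⟩ := exists_linearMap_apply_eq_single (A := S) m hm'
  refine ⟨∑ j, (LinearMap.proj j ∘ₗ φ).smulRight (Algebra.Extension.Cotangent.mk (x j)), ?_⟩
  apply LinearMap.ext_on (Algebra.Extension.Cotangent.span_eq_top_of_span_eq_ker (P := P') f hspan')
  rintro _ ⟨i, rfl⟩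
  rw [LinearMap.comp_apply, LinearMap.id_apply, LinearMap.sum_apply]
  simp only [LinearMap.smulRight_apply, LinearMap.comp_apply, LinearMap.proj_apply]
  have hφi : φ (P'.cotangentComplex (Algebra.Extension.Cotangent.mk (x i))) = Pi.single i 1 :=
    hφ i
  change ∑ j, φ (P'.cotangentComplex (Algebra.Extension.Cotangent.mk (x i))) j •
      Algebra.Extension.Cotangent.mk (x j) = Algebra.Extension.Cotangent.mk (x i)
  rw [hφi]
  simp only [Pi.single_apply, ite_smul, one_smul, zero_smul, Finset.sum_ite_eq',
    Finset.mem_univ, if_true]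


/-- **A regular local ring essentially of finite type over a field of characteristic `p` is
formally smooth over `𝔽_p`.** The ring is `B_𝔮` for the finitely generated subalgebra `B` of
which it is a localisation (`Algebra.EssFiniteType.subalgebra`) and the contraction `𝔮` of its
maximal ideal, so `formallySmooth_zmod_localization_of_isRegularLocalRing` applies.
[cite: StacksProject, Tag 031I] -/
theorem formallySmooth_zmod_of_isRegularLocalRing_of_essFiniteType (p : ℕ) [Fact p.Prime]
    (k A : Type u) [Field k] [CharP k p] [CommRing A] [Algebra k A] [Algebra.EssFiniteType k A]
    [IsRegularLocalRing A] [Algebra (ZMod p) A] : Algebra.FormallySmooth (ZMod p) A := by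
  -- adapted from `formallySmooth_of_isRegularLocalRing_of_perfectField` (`SmoothOfRegularFibre.lean`)
  let B : Subalgebra k A := Algebra.EssFiniteType.subalgebra k A
  let M : Submonoid B := (IsUnit.submonoid A).comap (algebraMap B A)
  haveI hM : IsLocalization M A := Algebra.EssFiniteType.isLocalization k A
  let q : Ideal B := (maximalIdeal A).comap (algebraMap B A)
  haveI hq : q.IsPrime := Ideal.comap_isPrime _ _
  have hMq : M = q.primeCompl := by
    ext b
    simp only [M, q, Submonoid.mem_comap, IsUnit.mem_submonoid_iff, Ideal.mem_primeCompl_iff,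
      Ideal.mem_comap, mem_maximalIdeal, mem_nonunits_iff, not_not]
  haveI : IsLocalization q.primeCompl A := by rw [← hMq]; exact hM
  let e : Localization.AtPrime q ≃ₐ[B] A :=
    IsLocalization.algEquiv q.primeCompl (Localization.AtPrime q) A
  haveI : IsRegularLocalRing (Localization.AtPrime q) :=
    IsRegularLocalRing.of_ringEquiv e.toRingEquiv.symm
  -- the `𝔽_p`-algebra structures
  haveI : CharP A p := charP_of_injective_algebraMap (algebraMap k A).injective p
  haveI : CharP (Localization.AtPrime q) p :=
    charP_of_injective_ringHom (f := e.symm.toRingEquiv.toRingHom) e.symm.injective p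
  letI : Algebra (ZMod p) (Localization.AtPrime q) := ZMod.algebra _ p
  have hsm : Algebra.FormallySmooth (ZMod p) (Localization.AtPrime q) :=
    formallySmooth_zmod_localization_of_isRegularLocalRing p k B q
  have he : (e : Localization.AtPrime q →+* A).comp (algebraMap (ZMod p) (Localization.AtPrime q)) =
      algebraMap (ZMod p) A := RingHom.ext_zmod _ _
  let e' : Localization.AtPrime q ≃ₐ[ZMod p] A :=
    AlgEquiv.ofRingEquiv (f := e.toRingEquiv) fun r => RingHom.congr_fun he r
  exact Algebra.FormallySmooth.of_equiv e'

end PrimeField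

end Literature.AlgebraicGeometry.Resolution

end
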